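/-
Copyright: the b2b-balaban T⁴-continuum CRUX team, row NE7b, leaf prover `t4-ne7b-formalise-leaf-01` (gen 78), for the
OWNER lineage `t4-ne7b-p1` (gen 105's `GaussianDominatedMoment`; price target W-ne7bp1-g104-3 (ii)) and the refuter desk
(PRICING-NE7b F346 ∕ F353 ∕ F362). Project licence.
-/
import Summits.QuantumFields.BalabanUV.T4Continuum.Spine.NE7b.GaussianDominatedMoment
import Mathlib.Analysis.SpecialFunctions.Gaussian.GaussianIntegral

/-!
# GAUSSIAN RANK-LOCAL EXPONENTIAL MOMENT — COROLLARIES OF THE OWNER's DOMINATION LEMMA in the `(A, B, δ)` letters of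
# `LocCondStability`'s carrier `M = e^{δQ_Z}`, and SHARPNESS (the constant is attained)

Cell `pub-balaban`, sub-cell `t4`, spine estimate NE7b (`T4WeightBudget.RelWeightBound` — the cell's OWN estimate, NOT
PRINTED in [Bałaban 1983–89], NOT PROVED).  Crux-route MODEL work under `Spine/NE7b/`: real analysis; it types NO
`T4Continuum/Support` leaf, mints no `Prop`, names no object of [B15]∕[B16], carries no `[cite:]` tag; 0 `sorry`.

WHY.  The OWNER's `GaussianDominatedMoment.integral_exp_qf_le_of_dominated` (p359207) is [B16] p. 383 l. 21–23 «positivity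
properties of the quadratic forms ⇒ factors exp O(1)|Z_j ∩ Ω_j|» as a theorem of finite-dimensional analysis: for `S` positive
definite, `Q` positive semidefinite, `Q ≤ δS`, `rank Q ≤ r`, `∫ e^{xᵀQx} e^{−xᵀSx} ≤ (√(1−δ))⁻¹ ^ r · ∫ e^{−xᵀSx}`.  THIS FILE
(typed the same morning; its first staging be12a3b3da19a864 re-proved the lemma from scratch and is SUPERSEDED by this re-base
on the owner's kernel objects, which are used BY NAME) keeps only what is not in the owner's file:
* §1 the lemma in the `(A, B, δ)` LETTERS of `LocalConditionalStability.LocCondStability`'s docstring (`M = e^{δQ_{j,Z}}`: term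
  density `e^{−xᵀAx}`, sacrificed part `δ·xᵀBx` with `0 ≤ B ≤ A`, exact exponent `rank B`) — `integral_exp_qf_le`,
  `integrable_exp_qf`, `integrable_exp_neg_qf` and the `LocCondStability`-SHAPED pair `gaussian_model_locCondStability`
  (integrability ∧ `∫ M·e ≤ e^{b}·∫ e`, `b = rank B·(−log(1−δ)∕2)`) — three-line corollaries (`Q := δ•B`, `S := A`,
  `rank (δ•B) ≤ rank B`); these are the sockets of the companions `GaussianRankLocalMomentShift` (pinned exterior),
  `GaussianRankLocalMomentTower` (the LCS road's four displays jointly inhabited by a continuum Gaussian; refuter F362 (a)) and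
  `GaussianRankLocalMomentFluct` (two-field fluctuation step).
* §2 **RANK-LOCALITY IS SHARP AT EVERY RANK** `integral_exp_qf_indicator_eq`: with identity precision and `C` the coordinate
  projection onto a set `S` of modes (`rank C = |S| ≤ |ι|`), `∫ e^{δ zᵀCz} e^{−zᵀz} dz = (√(1−δ))⁻¹ ^ |S| · ∫ e^{−zᵀz} dz` — the
  constant is ATTAINED with the exponent `|S|`, NOT the dimension `|ι|` (the owner's `GaussianDeterminant.gaussianMoment_eq_of_saturated`
  is the full-rank case `Q = δS`, exponent `|ι|`; his `gaussianMoment_eq` is the closed form behind both), by Fubini on `ι → ℝ` and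
  the one-variable Gaussian (`integral_prod_gaussian`: `∫ Π e^{−c_i z_i²} = Π √(π∕c_i)`).

NOT HERE (honest).  Nothing about Bałaban's densities: no small-field characteristic functions, no normalisation constants ∕
counterterms — the `O(1)·log g_j⁻²·|Z_j|` letter of [Balaban1989LargeFieldII] p. 380 l. 13–17 (refuter F353: `b` log-inherits in
print) is NOT modelled, nor the gauge-fixed Poincaré mechanism (1.8) (F346); no (A1c) inhabitant of `LocCondStability`.  BY-NAME
EFFECT ON THE WALL: NONE.  NE7b NOT PRINTED ∕ NOT PROVED; spine PROVED 0∕9; rung (B)+1 on a FINITE torus — NOT infinite volume,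
NOT the mass gap, NOT Clay.
HONEST DEPENDENCY: continuum YM on T⁴ ⇐ BetaPertH ∧ nine spine estimates (0/9 proved); BetaPertH ⇐ (D1) ∧ (D4) ∧ CAP+tail;
G-an2-4 gates asym, D1 and NE2/3/4.
-/

set_option autoImplicit false

open MeasureTheory Real Matrix Finset
open Summit.QuantumFields.BalabanUV.T4Continuum.NE7b.QuadFormSimDiag
open Summit.QuantumFields.BalabanUV.T4Continuum.NE7b.GaussianDominatedMoment

namespace Summit.QuantumFields.BalabanUV.T4Continuum.NE7b.GaussianRankLocalMoment

variable {ι : Type} [Fintype ι] [DecidableEq ι]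

/-! ## §1 The domination lemma in the `(A, B, δ)` letters of `LocCondStability`'s carrier -/

/-- `rank (δ•B) ≤ rank B`. [folklore] -/
theorem rank_smul_le (δ : ℝ) (B : Matrix ι ι ℝ) : (δ • B).rank ≤ B.rank := by
  rw [smul_eq_diagonal_mul]; exact rank_mul_le_right _ _

/-- **GAUSSIAN RANK-LOCAL EXPONENTIAL MOMENT** (= the owner's `integral_exp_qf_le_of_dominated` with `Q := δ•B`, `S := A`,
`r := rank B`).  For a positive-definite real precision `A` (ANY correlations between the modes), a sacrificed quadratic part
`0 ≤ B ≤ A` (Loewner) and `0 ≤ δ < 1`:  `∫ e^{δ xᵀBx} e^{−xᵀAx} dx ≤ (√(1−δ))⁻¹ ^ rank B · ∫ e^{−xᵀAx} dx` — the constant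
sees ONLY `rank B` (the degrees of freedom the sacrificed part touches) and `δ`: not `|ι|`, not `A` (β-free). [folklore] -/
theorem integral_exp_qf_le {A B : Matrix ι ι ℝ} (hA : A.PosDef) (hB : B.PosSemidef) (hAB : (A - B).PosSemidef)
    {δ : ℝ} (hδ0 : 0 ≤ δ) (hδ1 : δ < 1) :
    ∫ x : ι → ℝ, exp (δ * (x ⬝ᵥ (B *ᵥ x))) * exp (-(x ⬝ᵥ (A *ᵥ x))) ≤
      (√(1 - δ))⁻¹ ^ B.rank * ∫ x : ι → ℝ, exp (-(x ⬝ᵥ (A *ᵥ x))) := by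
  have hdom : (δ • A - δ • B).PosSemidef := by rw [← smul_sub]; exact hAB.smul hδ0
  simpa only [qf_smul] using
    integral_exp_qf_le_of_dominated hA (hB.smul hδ0) hdom hδ0 hδ1 (rank_smul_le δ B)

/-- Integrability of `e^{δ xᵀBx} e^{−xᵀAx}` under the same hypotheses (= the owner's `integrable_exp_qf_mul_exp_neg_qf`). [folklore] -/
theorem integrable_exp_qf {A B : Matrix ι ι ℝ} (hA : A.PosDef) (hB : B.PosSemidef) (hAB : (A - B).PosSemidef)
    {δ : ℝ} (hδ0 : 0 ≤ δ) (hδ1 : δ < 1) :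
    Integrable (fun x : ι → ℝ => exp (δ * (x ⬝ᵥ (B *ᵥ x))) * exp (-(x ⬝ᵥ (A *ᵥ x)))) := by
  have hdom : (δ • A - δ • B).PosSemidef := by rw [← smul_sub]; exact hAB.smul hδ0
  simpa only [qf_smul] using integrable_exp_qf_mul_exp_neg_qf hA (hB.smul hδ0) hdom hδ1

/-- The un-sacrificed Gaussian `e^{−xᵀAx}` is integrable (`δ = 0`, `B = 0`). [folklore] -/
theorem integrable_exp_neg_qf {A : Matrix ι ι ℝ} (hA : A.PosDef) :
    Integrable (fun x : ι → ℝ => exp (-(x ⬝ᵥ (A *ᵥ x)))) := by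
  have := integrable_exp_qf (B := 0) hA Matrix.PosSemidef.zero (by simpa using hA.posSemidef) le_rfl zero_lt_one
  simpa using this

/-- **THE MODEL INHABITANT OF `LocCondStability`'s SHAPE.**  With term density `e(x) = e^{−xᵀAx}` (any positive-definite
precision — the region's modes CORRELATED with all the others) and moment carrier `M(x) = e^{δ xᵀBx}` (the fraction `δ` of the
part `0 ≤ B ≤ A` of the action, `rank B` = the region's degrees of freedom): `M·e` is integrable and `∫ M·e ≤ e^{b}·∫ e` with
`b = rank B·(−log(1−δ)∕2)` (the owner's `inv_sqrt_pow_eq_exp` currency) — extensive in the REGION, uniform in the volume and in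
the precision.  This is the pair (integrability, inequality) that `LocalConditionalStability.LocCondStability` asks per pinned
step, for the RAW carrier against a Gaussian level state (the owner's `locCondStability_of_carrier_le` is the complementary
junction from a POINTWISE carrier bound); it says NOTHING about Bałaban's densities. [folklore] -/
theorem gaussian_model_locCondStability {A B : Matrix ι ι ℝ} (hA : A.PosDef) (hB : B.PosSemidef) (hAB : (A - B).PosSemidef)
    {δ : ℝ} (hδ0 : 0 ≤ δ) (hδ1 : δ < 1) :
    Integrable (fun x : ι → ℝ => exp (δ * (x ⬝ᵥ (B *ᵥ x))) * exp (-(x ⬝ᵥ (A *ᵥ x)))) ∧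
      ∫ x : ι → ℝ, exp (δ * (x ⬝ᵥ (B *ᵥ x))) * exp (-(x ⬝ᵥ (A *ᵥ x))) ≤
        exp ((B.rank : ℝ) * (-Real.log (1 - δ) / 2)) * ∫ x : ι → ℝ, exp (-(x ⬝ᵥ (A *ᵥ x))) :=
  ⟨integrable_exp_qf hA hB hAB hδ0 hδ1, by
    rw [← inv_sqrt_pow_eq_exp hδ1]; exact integral_exp_qf_le hA hB hAB hδ0 hδ1⟩

/-! ## §2 Sharpness: on a coordinate block the constant is ATTAINED (decided up to the Gaussian integral; says nothing about
Bałaban's objects) -/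

omit [DecidableEq ι] in
/-- `e^{−zᵀz} = Π_i e^{−1·z_i²}`. [folklore] -/
theorem exp_neg_dotProduct_self (z : ι → ℝ) : exp (-(z ⬝ᵥ z)) = ∏ i, exp (-1 * z i ^ 2) := by
  rw [← Real.exp_sum, dotProduct, ← Finset.sum_neg_distrib]
  exact congrArg exp (Finset.sum_congr rfl fun i _ => by ring)

omit [DecidableEq ι] in
/-- `e^{δ Σ μ_i w_i²} · e^{−wᵀw} = Π_i e^{−(1 − δ μ_i) w_i²}`. [folklore] -/
theorem exp_mul_sum_mul_exp_neg_dotProduct (μ w : ι → ℝ) (δ : ℝ) :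
    exp (δ * ∑ i, μ i * w i ^ 2) * exp (-(w ⬝ᵥ w)) = ∏ i, exp (-(1 - δ * μ i) * w i ^ 2) := by
  rw [← Real.exp_add, ← Real.exp_sum, dotProduct, Finset.mul_sum, ← sub_eq_add_neg, ← Finset.sum_sub_distrib]
  exact congrArg exp (Finset.sum_congr rfl fun i _ => by ring)

omit [DecidableEq ι] in
/-- **PRODUCT GAUSSIAN INTEGRAL**: `∫ Π_i e^{−c_i z_i²} dz = Π_i √(π / c_i)` (Fubini on `ι → ℝ` + the one-variable Gaussian). [folklore] -/
theorem integral_prod_gaussian (c : ι → ℝ) :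
    ∫ z : ι → ℝ, ∏ i, exp (-c i * z i ^ 2) = ∏ i, √(π / c i) := by
  rw [integral_fintype_prod_volume_eq_prod (fun i t => exp (-c i * t ^ 2))]
  exact Finset.prod_congr rfl fun i _ => integral_gaussian (c i)

omit [DecidableEq ι] in
/-- `∫ e^{−zᵀz} dz = √π ^ |ι|`. [folklore] -/
theorem integral_exp_neg_dotProduct_self : ∫ z : ι → ℝ, exp (-(z ⬝ᵥ z)) = √π ^ Fintype.card ι := by
  simp_rw [exp_neg_dotProduct_self]
  rw [integral_prod_gaussian, Finset.prod_congr rfl fun i _ => by rw [div_one], Finset.prod_const, Finset.card_univ]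

/-- **THE CONSTANT IS ATTAINED.**  Identity precision, `C` = the coordinate projection onto a set `S` of modes:
`∫ e^{δ zᵀCz} e^{−zᵀz} dz = (√(1−δ))⁻¹ ^ |S| · ∫ e^{−zᵀz} dz` (`δ < 1`) — the domination lemma's constant with `r = rank C = |S|`
is sharp, and its hypotheses (`0 ≤ C ≤ δ⁻¹·δ·1`) are inhabited with EQUALITY, non-vacuously. [folklore] -/
theorem integral_exp_qf_indicator_eq (S : Finset ι) {δ : ℝ} (hδ1 : δ < 1) :
    ∫ z : ι → ℝ, exp (δ * (z ⬝ᵥ (diagonal (fun i => if i ∈ S then (1 : ℝ) else 0) *ᵥ z))) * exp (-(z ⬝ᵥ z)) =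
      (√(1 - δ))⁻¹ ^ S.card * ∫ z : ι → ℝ, exp (-(z ⬝ᵥ z)) := by
  rw [integral_exp_neg_dotProduct_self]
  simp_rw [qf_diagonal, exp_mul_sum_mul_exp_neg_dotProduct, integral_prod_gaussian]
  have hpt : ∀ i, √(π / (1 - δ * if i ∈ S then (1 : ℝ) else 0)) = (if i ∈ S then (√(1 - δ))⁻¹ else 1) * √π := by
    intro i; split_ifs
    · rw [mul_one, Real.sqrt_div' _ (by linarith : (0 : ℝ) ≤ 1 - δ), div_eq_inv_mul]
    · rw [mul_zero, sub_zero, div_one, one_mul]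
  rw [Finset.prod_congr rfl fun i _ => hpt i, Finset.prod_mul_distrib, Finset.prod_ite_mem, Finset.univ_inter,
    Finset.prod_const, Finset.prod_const, Finset.card_univ]

end Summit.QuantumFields.BalabanUV.T4Continuum.NE7b.GaussianRankLocalMoment
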